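import Summits.HodgeConjecture.HodgeConjecture.Theorems.PadicSemiregularLiftHodgeFermatVarietiesPairedOfLargePrimesNull
import HarnessLib

/-!
# Short character-sum configurations, II: odd-annihilated ones are even

Crux `HodgeFermatVarieties` (stmt-HodgeConjecture-1334), line `cancel-by-any-claim-lattice`, stub S6
`stub_pairedOfLargePrimes` (lead c2), analytic half continued (part I: `…PairedOfLargePrimesNull`).

* `even_of_oddNull` — if every prime factor of `N` is `≥ 5`, `T : ℤ/N → ℂ` is supported on units,
  `∑ₓ T(x) χ(x) = 0` for every ODD primitive character `χ` mod `N`, and the support of `T` has at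
  most `p - 3` points for every prime `p ∣ N`, then `T(-x) = T(x)`. Proof: pair-splitting at one
  prime power `q = pᵉ ∥ N` (`annihilated_restrict_pair` of `FermatHodgeCharacterRigidity`, with a free
  element from `exists_free_pair` (`e = 1`, weight lemma) / `exists_free_of_card_lt` (`e ≥ 2`)); the
  difference `b ↦ T(crt⁻¹(a₀, b)) - T(crt⁻¹(-a₀, -b))` is then null at level `N/q` (primitive
  characters of both parities exist mod `q`) with no larger support, hence zero by `eq_zero_of_null`.

Everything here is proved; no named facts.

References: [Aoki1983] N. Aoki, Math. Ann. 266 (1983) 23–54, §§3–6 (Prop. 6.4: pair-splitting under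
`p > ℓ`), text read through the tree files `FermatHodgeCharacter*`.
-/

set_option linter.dupNamespace false

noncomputable section

open Finset
open Literature.AlgebraicGeometry.HodgeTheory Literature.AlgebraicGeometry.HodgeTheory.FermatCharacter

namespace Summit.HodgeConjecture.HodgeConjecture.Theorems.CancelByAnyClaimLattice

namespace PairedNull

/-! ### Odd-annihilated configurations with short support are even -/

section Even

variable {q n : ℕ} [NeZero q] [NeZero n]

/-- **The pair sum in fibre coordinates.** For the restriction of `T` to the two fibres over
`±a₀` mod `q` (`a₀ ≠ -a₀`) and a product character `χ₁ ⊠ χ₂`: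
`∑ₓ T'(x) (χ₁ ⊠ χ₂)(x) = χ₁(a₀) · (∑_b T(crt⁻¹(a₀,b)) χ₂(b) + χ₁(-1) χ₂(-1) ∑_b T(crt⁻¹(-a₀,-b)) χ₂(b))`.
[folklore] -/
theorem sum_restrict_pair_prodChar (h : q.Coprime n) (T : ZMod (q * n) → ℂ) (a₀ : (ZMod q)ˣ)
    (hne : (a₀ : ZMod q) ≠ -a₀) (χ₁ : DirichletCharacter ℂ q) (χ₂ : DirichletCharacter ℂ n) :
    ∑ x : ZMod (q * n), (if ZMod.castHom (dvd_mul_right q n) (ZMod q) x = a₀ ∨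
        ZMod.castHom (dvd_mul_right q n) (ZMod q) x = -a₀ then T x else 0) *
      (DirichletCharacter.changeLevel (dvd_mul_right q n) χ₁ *
        DirichletCharacter.changeLevel (dvd_mul_left n q) χ₂) x =
    χ₁ a₀ * (∑ b : ZMod n, T ((ZMod.chineseRemainder h).symm (a₀, b)) * χ₂ b +
      χ₁ (-1) * χ₂ (-1) * ∑ b : ZMod n, T ((ZMod.chineseRemainder h).symm (-(a₀ : ZMod q), -b)) * χ₂ b) := by
  classical
  haveI : NeZero (q * n) := ⟨mul_ne_zero (NeZero.ne q) (NeZero.ne n)⟩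
  rw [sum_eq_sum_crt h]
  have hterm : ∀ (a : ZMod q) (b : ZMod n),
      (if ZMod.castHom (dvd_mul_right q n) (ZMod q) ((ZMod.chineseRemainder h).symm (a, b)) = a₀ ∨
          ZMod.castHom (dvd_mul_right q n) (ZMod q) ((ZMod.chineseRemainder h).symm (a, b)) = -a₀ then
          T ((ZMod.chineseRemainder h).symm (a, b)) else 0) *
        (DirichletCharacter.changeLevel (dvd_mul_right q n) χ₁ *
          DirichletCharacter.changeLevel (dvd_mul_left n q) χ₂) ((ZMod.chineseRemainder h).symm (a, b)) =
      if a = a₀ ∨ a = -a₀ then χ₁ a * (T ((ZMod.chineseRemainder h).symm (a, b)) * χ₂ b) else 0 := by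
    intro a b
    rw [(castHom_crt_symm h a b).1, prodChar_apply, (castHom_crt_symm h a b).1, (castHom_crt_symm h a b).2]
    split_ifs <;> ring
  simp_rw [hterm]
  have hsum : ∀ a : ZMod q, ∑ b : ZMod n,
      (if a = a₀ ∨ a = -a₀ then χ₁ a * (T ((ZMod.chineseRemainder h).symm (a, b)) * χ₂ b) else 0) =
      if a = a₀ ∨ a = -a₀ then χ₁ a * ∑ b : ZMod n, T ((ZMod.chineseRemainder h).symm (a, b)) * χ₂ b
        else 0 := by
    intro a
    split_ifs
    · rw [Finset.mul_sum]
    · exact Finset.sum_const_zero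
  simp_rw [hsum]
  rw [Finset.sum_ite, Finset.sum_const_zero, add_zero]
  have hfilter : (univ.filter fun a : ZMod q ↦ a = a₀ ∨ a = -a₀) = {(a₀ : ZMod q), -(a₀ : ZMod q)} := by
    ext a
    simp only [mem_filter, mem_univ, true_and, mem_insert, mem_singleton]
  rw [hfilter, Finset.sum_pair hne]
  -- reindex the second fibre by `b ↦ -b`
  have hreindex : ∑ b : ZMod n, T ((ZMod.chineseRemainder h).symm (-(a₀ : ZMod q), b)) * χ₂ b =
      χ₂ (-1) * ∑ b : ZMod n, T ((ZMod.chineseRemainder h).symm (-(a₀ : ZMod q), -b)) * χ₂ b := by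
    rw [← sum_neg_mul_char (fun b ↦ T ((ZMod.chineseRemainder h).symm (-(a₀ : ZMod q), -b))) χ₂]
    simp only [neg_neg]
  rw [hreindex, show χ₁ (-(a₀ : ZMod q)) = χ₁ (-1) * χ₁ a₀ by rw [← map_mul, neg_one_mul]]
  ring

/-- **The difference function of a pair-annihilated restriction is null.** If the restriction of
`T` to the fibres over `±a₀` mod `q` is annihilated by every ODD primitive character mod `qn`, and
primitive characters of BOTH parities exist mod `q`, then
`D(b) = T(crt⁻¹(a₀, b)) - T(crt⁻¹(-a₀, -b))` is annihilated by EVERY primitive character mod `n`.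
[cite: Aoki1983, Lemma 3.2] -/
theorem diff_null_of_pair_annihilated (h : q.Coprime n) (T : ZMod (q * n) → ℂ) (a₀ : (ZMod q)ˣ)
    (hne : (a₀ : ZMod q) ≠ -a₀)
    (hPo : ∃ χ₁ : DirichletCharacter ℂ q, χ₁.Odd ∧ χ₁.IsPrimitive)
    (hPe : ∃ χ₁ : DirichletCharacter ℂ q, χ₁.Even ∧ χ₁.IsPrimitive)
    (hT : ∀ χ : DirichletCharacter ℂ (q * n), χ.Odd → χ.IsPrimitive →
      ∑ x : ZMod (q * n), (if ZMod.castHom (dvd_mul_right q n) (ZMod q) x = a₀ ∨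
        ZMod.castHom (dvd_mul_right q n) (ZMod q) x = -a₀ then T x else 0) * χ x = 0)
    (χ₂ : DirichletCharacter ℂ n) (hχ₂ : χ₂.IsPrimitive) :
    ∑ b : ZMod n, (T ((ZMod.chineseRemainder h).symm (a₀, b)) -
      T ((ZMod.chineseRemainder h).symm (-(a₀ : ZMod q), -b))) * χ₂ b = 0 := by
  classical
  haveI : NeZero (q * n) := ⟨mul_ne_zero (NeZero.ne q) (NeZero.ne n)⟩
  -- a primitive `χ₁` mod `q` of parity opposite to `χ₂`
  obtain ⟨χ₁, hprod, hprim₁⟩ : ∃ χ₁ : DirichletCharacter ℂ q, χ₁ (-1) * χ₂ (-1) = -1 ∧ χ₁.IsPrimitive := by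
    rcases char_neg_one_eq_or χ₂ with h2 | h2
    · obtain ⟨χ₁, ho, hp⟩ := hPo
      exact ⟨χ₁, by rw [ho, h2]; norm_num, hp⟩
    · obtain ⟨χ₁, hev, hp⟩ := hPe
      exact ⟨χ₁, by rw [hev, h2]; norm_num, hp⟩
  have hodd : (DirichletCharacter.changeLevel (dvd_mul_right q n) χ₁ *
      DirichletCharacter.changeLevel (dvd_mul_left n q) χ₂).Odd := by
    rw [DirichletCharacter.Odd, prodChar_neg_one, hprod]
  have key := hT _ hodd (prodChar_isPrimitive h hprim₁ hχ₂)
  rw [sum_restrict_pair_prodChar h T a₀ hne χ₁ χ₂, hprod] at key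
  have hχa : χ₁ a₀ ≠ 0 := fun h0 ↦ by
    have := χ₁.unit_norm_eq_one a₀
    rw [h0, norm_zero] at this
    exact zero_ne_one this
  have hAB := (mul_eq_zero.mp key).resolve_left hχa
  have hsplit : ∑ b : ZMod n, (T ((ZMod.chineseRemainder h).symm (a₀, b)) -
      T ((ZMod.chineseRemainder h).symm (-(a₀ : ZMod q), -b))) * χ₂ b =
      ∑ b : ZMod n, T ((ZMod.chineseRemainder h).symm (a₀, b)) * χ₂ b -
        ∑ b : ZMod n, T ((ZMod.chineseRemainder h).symm (-(a₀ : ZMod q), -b)) * χ₂ b := by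
    rw [← Finset.sum_sub_distrib]
    exact Finset.sum_congr rfl fun b _ ↦ by ring
  rw [hsplit]
  linear_combination hAB

/-- **Odd-annihilated configurations with at most `p - 3` points (every `p ∣ N`) are even.** Let
every prime factor of `N` be `≥ 5`, let `T : ℤ/N → ℂ` be supported on units with
`∑ₓ T(x) χ(x) = 0` for every ODD primitive character `χ` mod `N`, and assume `#supp T + 2 < p`
for every prime `p ∣ N`. Then `T(-x) = T(x)` for all `x`. (At the prime power `q = pᵉ ∥ N`
through which we look at `x`, a free pair exists by counting — `exists_free_pair` for `e = 1`
with the weight lemma, `exists_free_of_card_lt` for `e ≥ 2` — so the restriction of `T` to the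
fibres over `±(x mod q)` is again odd-annihilated (`annihilated_restrict_pair`); its difference
function is null at level `N/q` (`diff_null_of_pair_annihilated`) with no larger support, hence
zero (`eq_zero_of_null`).) [cite: Aoki1983, Prop. 6.4] -/
theorem even_of_oddNull : ∀ {N : ℕ} [NeZero N], (∀ p ∈ N.primeFactors, 5 ≤ p) → ∀ (T : ZMod N → ℂ), (∀ x, ¬ IsUnit x → T x = 0) → (∀ χ : DirichletCharacter ℂ N, χ.Odd → χ.IsPrimitive → ∑ x : ZMod N, T x * χ x = 0) → (∀ p ∈ N.primeFactors, #(univ.filter fun x : ZMod N ↦ T x ≠ 0) + 2 < p) → ∀ (x : ZMod N), T (-x) = T x := by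
  intro N _ hN5 T hTu hT hcard x
  classical
  have hN0 : N ≠ 0 := NeZero.ne N
  by_cases hN1 : N = 1
  · subst hN1
    haveI : Subsingleton (ZMod 1) := ZMod.subsingleton_iff.mpr rfl
    rw [Subsingleton.elim (-x) x]
  by_cases hx : IsUnit x
  swap
  · rw [hTu x hx, hTu (-x) (fun h ↦ hx (by simpa using h.neg))]
  obtain ⟨p, e, n, hp, he, hpn, hcop, rfl⟩ := exists_primePow_mul hN0 hN1
  haveI : NeZero (p ^ e) := ⟨pow_ne_zero e hp.ne_zero⟩
  have hn0 : n ≠ 0 := fun h0 ↦ hN0 (by rw [h0, mul_zero])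
  haveI : NeZero n := ⟨hn0⟩
  have hpN : p ∈ (p ^ e * n).primeFactors := by
    rw [Nat.mem_primeFactors]
    exact ⟨hp, dvd_mul_of_dvd_left (dvd_pow_self p (by omega)) n, hN0⟩
  have hp5 : 5 ≤ p := hN5 p hpN
  have hp2 : p ≠ 2 := by omega
  have hpodd : Odd p := hp.odd_of_ne_two hp2
  have hqodd : Odd (p ^ e) := hpodd.pow
  have hq5 : 5 ≤ p ^ e := le_trans hp5 (Nat.le_self_pow (by omega) p)
  have hq2 : 2 < p ^ e := by omega
  -- all prime factors of `n` are `≥ 5`; in particular `n` is odd and `n ≠ 3`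
  have hnfac : ∀ p' ∈ n.primeFactors, p' ∈ (p ^ e * n).primeFactors := fun p' hp' ↦ by
    rw [Nat.primeFactors_mul (NeZero.ne _) hn0]
    exact Finset.mem_union_right _ hp'
  have hnodd : Odd n := by
    rw [Nat.odd_iff]
    by_contra h2
    have h2n : 2 ∣ n := Nat.dvd_of_mod_eq_zero (by omega)
    have : 2 ∈ n.primeFactors := Nat.mem_primeFactors.mpr ⟨Nat.prime_two, h2n, hn0⟩
    have := hN5 2 (hnfac 2 this)
    omega
  have hn3 : n ≠ 3 := by
    intro h3
    have : 3 ∈ n.primeFactors := Nat.mem_primeFactors.mpr ⟨Nat.prime_three, by rw [h3], hn0⟩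
    have := hN5 3 (hnfac 3 this)
    omega
  have hn4 : n ≠ 4 := fun h4 ↦ by rw [h4] at hnodd; exact (by decide : ¬ Odd 4) hnodd
  -- the residues of `x`
  set a₀u : (ZMod (p ^ e))ˣ := (hx.map (ZMod.castHom (dvd_mul_right (p ^ e) n) (ZMod (p ^ e)))).unit
    with ha₀u
  have ha₀ : (a₀u : ZMod (p ^ e)) = ZMod.castHom (dvd_mul_right (p ^ e) n) (ZMod (p ^ e)) x :=
    IsUnit.unit_spec _
  set b₀ : ZMod n := ZMod.castHom (dvd_mul_left n (p ^ e)) (ZMod n) x with hb₀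
  have hne : (a₀u : ZMod (p ^ e)) ≠ -a₀u := by
    intro heq
    haveI : Fact (2 < p ^ e) := ⟨hq2⟩
    have h2 : (2 : ZMod (p ^ e)) * a₀u = 0 := by
      rw [two_mul]; nth_rewrite 2 [heq]; rw [add_neg_cancel]
    have h2' : (2 : ZMod (p ^ e)) = 0 := by
      have := congrArg (· * ((a₀u⁻¹ : (ZMod (p ^ e))ˣ) : ZMod (p ^ e))) h2
      simpa [mul_assoc] using this
    have hdvd : (p ^ e : ℕ) ∣ 2 := by
      rw [show (2 : ZMod (p ^ e)) = ((2 : ℕ) : ZMod (p ^ e)) by norm_cast] at h2'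
      exact (ZMod.natCast_eq_zero_iff 2 (p ^ e)).mp h2'
    exact absurd (Nat.le_of_dvd Nat.two_pos hdvd) (by omega)
  set S : Finset (ZMod (p ^ e * n)) := univ.filter fun y ↦ T y ≠ 0 with hS
  have hSp : #S + 2 < p := by rw [hS]; exact hcard p hpN
  -- STEP 1: the restriction of `T` to the fibres over `±a₀` is odd-annihilated
  have hpair : ∀ χ : DirichletCharacter ℂ (p ^ e * n), χ.Odd → χ.IsPrimitive →
      ∑ y : ZMod (p ^ e * n), (if ZMod.castHom (dvd_mul_right (p ^ e) n) (ZMod (p ^ e)) y = a₀u ∨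
        ZMod.castHom (dvd_mul_right (p ^ e) n) (ZMod (p ^ e)) y = -a₀u then T y else 0) * χ y = 0 := by
    rcases Nat.lt_or_ge e 2 with he1 | he2
    · -- `e = 1`: a free pair from the weight lemma
      have he1' : e = 1 := by omega
      have hprim1 : ∀ χ : DirichletCharacter ℂ (p ^ e), ¬ χ.FactorsThrough 1 → χ.IsPrimitive := by
        rw [he1', pow_one]
        exact fun χ hχ ↦ isPrimitive_of_not_factorsThrough_one_prime hp χ hχ
      have hPC : ∃ χ₂ : DirichletCharacter ℂ n, χ₂.Even ∧ χ₂.IsPrimitive :=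
        exists_even_isPrimitive (Or.inl hnodd) hn3 hn4
      have hcardq : #S < #(univ.filter fun a : ZMod (p ^ e) ↦ IsUnit a) := by
        have hunits : #(univ.filter fun a : ZMod (p ^ e) ↦ IsUnit a) = (p ^ e).totient :=
          card_filter_isUnit
        have htot : (p ^ e).totient = p - 1 := by rw [he1', pow_one, Nat.totient_prime hp]
        rw [hunits, htot]
        omega
      obtain ⟨a₁, ha₁⟩ := exists_free_pair hcop hq2 hprim1 hPC T hTu hT hcardq
      intro χ hχo hχp
      have := annihilated_restrict_pair hcop hq2 (one_dvd (p ^ e)) hprim1 T hT a₀u (a₀u⁻¹ * a₁)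
        (unitsMap_one_dvd _) (fun y hy ↦ ?_) χ hχo hχp
      · exact this
      · rw [Units.val_mul, ← mul_assoc, Units.mul_inv, one_mul]
        exact ha₁ y hy
    · -- `e ≥ 2`: a free kernel element by counting
      have hd := pow_dvd_pow p (Nat.sub_le e 1)
      have hprim : ∀ χ : DirichletCharacter ℂ (p ^ e), ¬ χ.FactorsThrough (p ^ (e - 1)) → χ.IsPrimitive :=
        fun χ hχ ↦ isPrimitive_of_not_factorsThrough_primePow hp he χ hχ
      have hm1 : ZMod.unitsMap hd (-1 : (ZMod (p ^ e))ˣ) ≠ 1 := by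
        refine unitsMap_neg_one_ne_one hd ?_
        calc 2 < 5 := by norm_num
          _ ≤ p := hp5
          _ ≤ p ^ (e - 1) := Nat.le_self_pow (by omega) p
      have hcardK : #S < #(univ.filter fun u : (ZMod (p ^ e))ˣ ↦ ZMod.unitsMap hd u = 1) := by
        rw [card_ker_primePow hp he2]
        omega
      obtain ⟨u, hu, hfreeS⟩ := exists_free_of_card_lt (n := n) hd hm1 S a₀u hcardK
      intro χ hχo hχp
      refine annihilated_restrict_pair hcop hq2 hd hprim T hT a₀u u hu (fun y hy ↦ ?_) χ hχo hχp
      exact hfreeS y (by rw [hS, mem_filter]; exact ⟨mem_univ _, hy⟩)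
  -- STEP 2: the difference function is null at level `n`
  set D : ZMod n → ℂ := fun b ↦ T ((ZMod.chineseRemainder hcop).symm (a₀u, b)) -
    T ((ZMod.chineseRemainder hcop).symm (-(a₀u : ZMod (p ^ e)), -b)) with hD
  have hq1 : p ^ e ≠ 1 := by omega
  have hq12 : p ^ e ≠ 12 := fun h12 ↦ by rw [h12] at hqodd; exact (by decide : ¬ Odd 12) hqodd
  have hq3 : p ^ e ≠ 3 := by omega
  have hq4 : p ^ e ≠ 4 := by omega
  have hDnull : ∀ χ₂ : DirichletCharacter ℂ n, χ₂.IsPrimitive → ∑ b : ZMod n, D b * χ₂ b = 0 :=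
    diff_null_of_pair_annihilated hcop T a₀u hne (exists_odd_isPrimitive (Or.inl hqodd) hq1 hq12)
      (exists_even_isPrimitive (Or.inl hqodd) hq3 hq4) hpair
  -- `D` is supported on units
  have hDu : ∀ b, ¬ IsUnit b → D b = 0 := by
    intro b hb
    have h1 : ¬ IsUnit ((ZMod.chineseRemainder hcop).symm ((a₀u : ZMod (p ^ e)), b)) := by
      rw [isUnit_crt_symm_iff]; exact fun hh ↦ hb hh.2
    have h2 : ¬ IsUnit ((ZMod.chineseRemainder hcop).symm (-(a₀u : ZMod (p ^ e)), -b)) := by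
      rw [isUnit_crt_symm_iff]; exact fun hh ↦ hb (by simpa using hh.2.neg)
    simp only [hD, hTu _ h1, hTu _ h2, sub_zero]
  -- `#supp D ≤ #supp T`
  have hDcard : #(univ.filter fun b : ZMod n ↦ D b ≠ 0) ≤ #S := by
    set f₁ : ZMod n → ZMod (p ^ e * n) := fun b ↦ (ZMod.chineseRemainder hcop).symm (a₀u, b) with hf₁
    set f₂ : ZMod n → ZMod (p ^ e * n) := fun b ↦ (ZMod.chineseRemainder hcop).symm (-(a₀u : ZMod (p ^ e)), -b)
      with hf₂
    set B₁ : Finset (ZMod n) := univ.filter fun b ↦ T (f₁ b) ≠ 0 with hB₁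
    set B₂ : Finset (ZMod n) := univ.filter fun b ↦ T (f₂ b) ≠ 0 with hB₂
    have hsub : (univ.filter fun b : ZMod n ↦ D b ≠ 0) ⊆ B₁ ∪ B₂ := by
      intro b hb
      rw [mem_filter] at hb
      rw [mem_union, hB₁, hB₂, mem_filter, mem_filter]
      by_contra hcon
      simp only [mem_univ, true_and, not_or, not_not] at hcon
      exact hb.2 (by simp only [hD]; rw [hcon.1, hcon.2, sub_zero])
    have hinj₁ : Function.Injective f₁ := fun b b' hbb ↦ by
      have := congrArg (ZMod.chineseRemainder hcop) hbb
      simp only [hf₁, RingEquiv.apply_symm_apply, Prod.mk.injEq] at this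
      exact this.2
    have hinj₂ : Function.Injective f₂ := fun b b' hbb ↦ by
      have := congrArg (ZMod.chineseRemainder hcop) hbb
      simp only [hf₂, RingEquiv.apply_symm_apply, Prod.mk.injEq, neg_inj] at this
      exact this.2
    have himg₁ : B₁.image f₁ ⊆ S.filter fun y ↦ ZMod.castHom (dvd_mul_right (p ^ e) n) (ZMod (p ^ e)) y = a₀u := by
      intro y hy
      obtain ⟨b, hb, rfl⟩ := mem_image.mp hy
      rw [mem_filter, hS, mem_filter]
      exact ⟨⟨mem_univ _, (mem_filter.mp hb).2⟩, (castHom_crt_symm hcop _ b).1⟩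
    have himg₂ : B₂.image f₂ ⊆ S.filter fun y ↦ ¬ ZMod.castHom (dvd_mul_right (p ^ e) n) (ZMod (p ^ e)) y = a₀u := by
      intro y hy
      obtain ⟨b, hb, rfl⟩ := mem_image.mp hy
      rw [mem_filter, hS, mem_filter]
      refine ⟨⟨mem_univ _, (mem_filter.mp hb).2⟩, ?_⟩
      rw [(castHom_crt_symm hcop _ _).1]
      exact fun h' ↦ hne h'.symm
    calc #(univ.filter fun b : ZMod n ↦ D b ≠ 0) ≤ #(B₁ ∪ B₂) := card_le_card hsub
      _ ≤ #B₁ + #B₂ := card_union_le _ _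
      _ = #(B₁.image f₁) + #(B₂.image f₂) := by
          rw [card_image_of_injective _ hinj₁, card_image_of_injective _ hinj₂]
      _ ≤ #(S.filter fun y ↦ ZMod.castHom (dvd_mul_right (p ^ e) n) (ZMod (p ^ e)) y = a₀u) +
            #(S.filter fun y ↦ ¬ ZMod.castHom (dvd_mul_right (p ^ e) n) (ZMod (p ^ e)) y = a₀u) :=
          Nat.add_le_add (card_le_card himg₁) (card_le_card himg₂)
      _ = #S := Finset.card_filter_add_card_filter_not _
  have hDshort : ∀ p' ∈ n.primeFactors, #(univ.filter fun b : ZMod n ↦ D b ≠ 0) + 1 < p' := by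
    intro p' hp'
    have h1 := hcard p' (hnfac p' hp')
    omega
  -- STEP 3: `D = 0`, i.e. `T(x) = T(-x)`
  have hD0 := eq_zero_of_null n D hDu hDnull hDshort b₀
  simp only [hD, sub_eq_zero] at hD0
  have hx' : (ZMod.chineseRemainder hcop).symm ((a₀u : ZMod (p ^ e)), b₀) = x := by
    rw [ha₀, hb₀]; exact crt_symm_castHom hcop x
  rw [crt_symm_neg, hx'] at hD0
  exact hD0.symm

end Even

end PairedNull

end Summit.HodgeConjecture.HodgeConjecture.Theorems.CancelByAnyClaimLattice

end
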